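import Literature.Analysis.SpecialFunctions.LegendrePolynomialsBonnet
import Literature.Analysis.SpecialFunctions.LegendreNikolskii
import Summits.NavierStokesRegularity.TurbBounds.LadderTail
import HarnessLib

/-!
# Legendre coefficient calculus for real polynomials on `[-1, 1]`: expansion, Parseval, the derivative identity
# `P'_{n+2} - P'_n = (2n+3) P_{n+1}`, the integration ladder, and polynomial antiderivatives
(cell `pub-turb` / `turb-bounds`; v2 staging of the tail lemma R-T — tool file; sources rbsdp SPEC §1.2 (FW16 App. A),
Jeffrey §18.2.5.1 (5); built on the tree's `Literature.Analysis.SpecialFunctions.LegendrePolynomials*` (Rodrigues definition,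
orthogonality, norms, Bonnet, `P_n(±1)`), nothing cited is restated.)

HONEST FRAMING: rigorous bounds for the stated PDE and boundary conditions; no claim about physical turbulence beyond the bound.
Everything here is elementary real analysis of polynomials, PROVED (no `sorry`, no named fact):
* `legCoeff p n = ((2n+1)/2) ∫_{-1}^1 p P_n` — the `n`-th Legendre coefficient; `eq_sum_legCoeff` (every `p` with `deg p ≤ N` is
  `Σ_{k ≤ N} ĉ_k P_k`), `legCoeff_eq_zero_of_lt` (`ĉ_n = 0` for `n > deg p`), `integral_mul_eq_sum` / `integral_sq_eq_sum`
  (finite PARSEVAL: `∫ p q = Σ w_k ĉ_k(p) ĉ_k(q)`, `w_k = 2/(2k+1)`);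
* `derivative_legendre_sub` : `P'_{n+2} - P'_n = (2n+3) P_{n+1}` [Jeffrey §18.2.5.1 (5)] — proved from orthogonality and degrees;
* `legCoeff_succ_of_wall`, `legCoeff_zero_of_wall` : the INTEGRATION LADDER of rbsdp SPEC 1.2 — if `P(-1) = 0` then the coefficients
  of `P` are `ĉ_{m+1}(P) = ĉ_m(P')/(2m+1) - ĉ_{m+2}(P')/(2m+5)` and `ĉ_0(P) = ĉ_0(P') - ĉ_1(P')/3`;
* `primFrom p` : the polynomial antiderivative vanishing at `-1` (`derivative_primFrom`, `eval_primFrom_neg_one`,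
  `eval_primFrom_eq_integral`, `natDegree_primFrom_le`).
-/

set_option linter.style.longLine false

noncomputable section

namespace Summit.NavierStokesRegularity.TurbBounds.LegendreCoeffs

open Polynomial intervalIntegral MeasureTheory Finset Literature.Analysis.SpecialFunctions
open Summit.NavierStokesRegularity.TurbBounds.LadderTail (w IsLadder)

/-! ## 1. The coefficient functional -/

/-- The `n`-th Legendre coefficient of a real polynomial: `ĉ_n(p) = ((2n+1)/2) ∫_{-1}^1 p P_n` (so that `p = Σ ĉ_n P_n`). -/
def legCoeff (p : ℝ[X]) (n : ℕ) : ℝ :=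
  (2 * (n : ℝ) + 1) / 2 * ∫ x in (-1 : ℝ)..1, p.eval x * (legendre n).eval x

/-- `w n = 2/(2n+1)` (`LadderTail.w`) is the tree's `∫_{-1}^1 P_n²`. -/
theorem w_eq (n : ℕ) : w n = 2 / (2 * (n : ℝ) + 1) := rfl

/-- `((2n+1)/2)·w_n = 1`. -/
theorem norm_mul_w (n : ℕ) : (2 * (n : ℝ) + 1) / 2 * w n = 1 := by
  rw [w_eq]; field_simp

/-- products of polynomial functions are interval integrable -/
private theorem ii (p q : ℝ[X]) :
    IntervalIntegrable (fun x => p.eval x * q.eval x) volume (-1 : ℝ) 1 :=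
  (p.continuous.mul q.continuous).intervalIntegrable _ _

/-- Additivity of `ĉ_n`. -/
theorem legCoeff_add (p q : ℝ[X]) (n : ℕ) : legCoeff (p + q) n = legCoeff p n + legCoeff q n := by
  unfold legCoeff
  have h : ∫ x in (-1 : ℝ)..1, (p + q).eval x * (legendre n).eval x
      = (∫ x in (-1 : ℝ)..1, p.eval x * (legendre n).eval x) + ∫ x in (-1 : ℝ)..1, q.eval x * (legendre n).eval x := by
    rw [← intervalIntegral.integral_add (ii p _) (ii q _)]
    refine intervalIntegral.integral_congr fun x _ => ?_
    simp only [eval_add]; ring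
  rw [h]; ring

/-- Subtractivity of `ĉ_n`. -/
theorem legCoeff_sub (p q : ℝ[X]) (n : ℕ) : legCoeff (p - q) n = legCoeff p n - legCoeff q n := by
  have h := legCoeff_add (p - q) q n
  rw [sub_add_cancel] at h
  linarith

/-- Homogeneity of `ĉ_n`. -/
theorem legCoeff_C_mul (a : ℝ) (p : ℝ[X]) (n : ℕ) : legCoeff (C a * p) n = a * legCoeff p n := by
  unfold legCoeff
  have h : ∫ x in (-1 : ℝ)..1, (C a * p).eval x * (legendre n).eval x
      = a * ∫ x in (-1 : ℝ)..1, p.eval x * (legendre n).eval x := by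
    rw [← intervalIntegral.integral_const_mul]
    refine intervalIntegral.integral_congr fun x _ => ?_
    simp only [eval_mul, eval_C]; ring
  rw [h]; ring

/-- `ĉ_n` of a finite sum. -/
theorem legCoeff_sum {ι : Type*} (s : Finset ι) (f : ι → ℝ[X]) (n : ℕ) :
    legCoeff (∑ i ∈ s, f i) n = ∑ i ∈ s, legCoeff (f i) n := by
  classical
  induction s using Finset.induction_on with
  | empty => simp [legCoeff]
  | insert a s ha ih => rw [sum_insert ha, sum_insert ha, legCoeff_add, ih]

/-- `ĉ_n(P_m) = δ_{mn}`. -/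
theorem legCoeff_legendre (m n : ℕ) : legCoeff (legendre m) n = if m = n then 1 else 0 := by
  unfold legCoeff
  rw [integral_legendre_mul_legendre]
  split_ifs with h
  · subst h; rw [← w_eq, norm_mul_w]
  · ring

/-- The coefficients of an explicit Legendre combination. -/
theorem legCoeff_expansion (N : ℕ) (α : ℕ → ℝ) (n : ℕ) :
    legCoeff (∑ k ∈ range (N + 1), C (α k) * legendre k) n = if n ≤ N then α n else 0 := by
  rw [legCoeff_sum]
  simp_rw [legCoeff_C_mul, legCoeff_legendre, mul_ite, mul_one, mul_zero]
  rw [sum_ite_eq']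
  simp only [mem_range, Nat.lt_succ_iff]

/-- `ĉ_n(p) = 0` for `n > deg p` (orthogonality of `P_n` to lower-degree polynomials). -/
theorem legCoeff_eq_zero_of_lt (p : ℝ[X]) {n : ℕ} (h : p.natDegree < n) : legCoeff p n = 0 := by
  unfold legCoeff
  have hdeg : p.degree < n := (degree_le_natDegree).trans_lt (by exact_mod_cast h)
  have h0 := integral_legendre_mul_eq_zero hdeg
  have e : ∫ x in (-1 : ℝ)..1, p.eval x * (legendre n).eval x = ∫ x in (-1 : ℝ)..1, (legendre n).eval x * p.eval x :=
    intervalIntegral.integral_congr fun x _ => by ring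
  rw [e, h0, mul_zero]

/-- **Legendre expansion**: a polynomial of degree `≤ N` is `Σ_{k ≤ N} ĉ_k P_k`. -/
theorem eq_sum_legCoeff (p : ℝ[X]) {N : ℕ} (h : p.natDegree ≤ N) :
    p = ∑ k ∈ range (N + 1), C (legCoeff p k) * legendre k := by
  obtain ⟨α, hα⟩ := exists_eq_sum_C_mul_legendre N p h
  have hc : ∀ k ∈ range (N + 1), legCoeff p k = α k := by
    intro k hk
    rw [hα, legCoeff_expansion, if_pos (by rw [mem_range] at hk; omega)]
  rw [hα]
  refine sum_congr rfl fun k hk => ?_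
  rw [← hα, hc k hk]

/-- **Finite Parseval (bilinear)**: `∫_{-1}^1 p q = Σ_{k ≤ N} w_k ĉ_k(p) ĉ_k(q)` when `deg p, deg q ≤ N`. -/
theorem integral_mul_eq_sum (p q : ℝ[X]) {N : ℕ} (hp : p.natDegree ≤ N) (hq : q.natDegree ≤ N) :
    ∫ x in (-1 : ℝ)..1, p.eval x * q.eval x = ∑ k ∈ range (N + 1), w k * legCoeff p k * legCoeff q k := by
  have hint : ∀ j k, IntervalIntegrable
      (fun x ↦ legCoeff p j * (legendre j).eval x * (legCoeff q k * (legendre k).eval x)) volume (-1) 1 :=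
    fun j k ↦ Continuous.intervalIntegrable (by fun_prop) _ _
  have hexp : ∀ x, p.eval x * q.eval x = ∑ j ∈ range (N + 1), ∑ k ∈ range (N + 1),
      legCoeff p j * (legendre j).eval x * (legCoeff q k * (legendre k).eval x) := by
    intro x
    conv_lhs => rw [eq_sum_legCoeff p hp, eq_sum_legCoeff q hq]
    rw [eval_finsetSum, eval_finsetSum, sum_mul_sum]
    refine sum_congr rfl fun j _ ↦ sum_congr rfl fun k _ ↦ ?_
    rw [eval_mul, eval_C, eval_mul, eval_C]
  simp_rw [hexp]
  rw [intervalIntegral.integral_finsetSum (fun j _ ↦ Continuous.intervalIntegrable (by fun_prop) _ _)]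
  refine sum_congr rfl fun j hj ↦ ?_
  rw [intervalIntegral.integral_finsetSum (fun k _ ↦ hint j k)]
  have hterm : ∀ k ∈ range (N + 1), ∫ x in (-1 : ℝ)..1,
      legCoeff p j * (legendre j).eval x * (legCoeff q k * (legendre k).eval x) =
      legCoeff p j * legCoeff q k * if j = k then w j else 0 := by
    intro k _
    rw [w_eq, ← integral_legendre_mul_legendre, ← intervalIntegral.integral_const_mul]
    refine intervalIntegral.integral_congr fun x _ ↦ ?_
    ring
  rw [sum_congr rfl hterm]
  simp_rw [mul_ite, mul_zero]
  rw [sum_ite_eq, if_pos hj]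
  ring

/-- **Finite Parseval**: `∫_{-1}^1 p² = Σ_{k ≤ N} w_k ĉ_k(p)²` when `deg p ≤ N`. -/
theorem integral_sq_eq_sum (p : ℝ[X]) {N : ℕ} (hp : p.natDegree ≤ N) :
    ∫ x in (-1 : ℝ)..1, p.eval x ^ 2 = ∑ k ∈ range (N + 1), w k * legCoeff p k ^ 2 := by
  have h := integral_mul_eq_sum p p hp hp
  have e : ∫ x in (-1 : ℝ)..1, p.eval x ^ 2 = ∫ x in (-1 : ℝ)..1, p.eval x * p.eval x :=
    intervalIntegral.integral_congr fun x _ => by ring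
  rw [e, h]
  exact sum_congr rfl fun k _ => by ring

/-- Parseval (bilinear) over any window `range R` with `deg p, deg q < R`. -/
theorem integral_mul_eq_sum_of_lt (p q : ℝ[X]) {R : ℕ} (hp : p.natDegree < R) (hq : q.natDegree < R) :
    ∫ x in (-1 : ℝ)..1, p.eval x * q.eval x = ∑ k ∈ range R, w k * legCoeff p k * legCoeff q k := by
  obtain ⟨N, rfl⟩ : ∃ N, R = N + 1 := ⟨R - 1, by omega⟩
  exact integral_mul_eq_sum p q (by omega) (by omega)

/-- Parseval over any window `range R` with `deg p < R`. -/
theorem integral_sq_eq_sum_of_lt (p : ℝ[X]) {R : ℕ} (hp : p.natDegree < R) :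
    ∫ x in (-1 : ℝ)..1, p.eval x ^ 2 = ∑ k ∈ range R, w k * legCoeff p k ^ 2 := by
  obtain ⟨N, rfl⟩ : ∃ N, R = N + 1 := ⟨R - 1, by omega⟩
  exact integral_sq_eq_sum p (by omega)

/-! ## 2. The derivative identity `P'_{n+2} - P'_n = (2n+3) P_{n+1}` -/

/-- `∫_{-1}^1 P_m · q' = 0` when `deg q ≤ m` (`deg q' < m`). -/
private theorem integral_legendre_mul_derivative_eq_zero {m k : ℕ} (hk : k ≤ m) :
    ∫ x in (-1 : ℝ)..1, (legendre m).eval x * (derivative (legendre k)).eval x = 0 := by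
  rcases Nat.eq_zero_or_pos k with rfl | hk0
  · simp [legendre_zero]
  refine integral_legendre_mul_eq_zero ?_
  have h1 : (derivative (legendre k)).degree < (legendre k).degree := degree_derivative_lt (legendre_ne_zero k)
  rw [degree_eq_natDegree (legendre_ne_zero k), natDegree_legendre] at h1
  exact h1.trans_le (by exact_mod_cast hk)

/-- **`P'_{n+2} - P'_n = (2n+3)·P_{n+1}`** [Jeffrey, Handbook §18.2.5.1 (5); rbsdp SPEC 1.2 = FW16 App. A]. Proof: the difference
`D` of the two sides has degree `≤ n` (the `X^{n+1}` coefficients agree by `p_{n+2} = (2n+3)/(n+2)·p_{n+1}`) and is orthogonal to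
`P_0 … P_n` (integrate by parts; `P_{n+2} - P_n` vanishes at `±1`), hence `D = 0`. -/
theorem derivative_legendre_sub (n : ℕ) :
    derivative (legendre (n + 2)) - derivative (legendre n) = C (2 * (n : ℝ) + 3) * legendre (n + 1) := by
  set D : ℝ[X] := derivative (legendre (n + 2)) - derivative (legendre n) - C (2 * (n : ℝ) + 3) * legendre (n + 1) with hD
  suffices hD0 : D = 0 by
    rw [hD] at hD0; exact sub_eq_zero.mp hD0
  -- degree ≤ n
  have hdeg : D.natDegree ≤ n := by
    rw [natDegree_le_iff_coeff_eq_zero]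
    intro m hm
    rw [hD, coeff_sub, coeff_sub, coeff_derivative, coeff_derivative, coeff_C_mul]
    have hm' : n < m := by exact_mod_cast hm
    rcases Nat.lt_or_ge (n + 1) m with hlt | hle
    · rw [coeff_eq_zero_of_natDegree_lt (by rw [natDegree_legendre]; omega),
        coeff_eq_zero_of_natDegree_lt (by rw [natDegree_legendre]; omega),
        coeff_eq_zero_of_natDegree_lt (by rw [natDegree_legendre]; omega)]
      ring
    · have hm1 : m = n + 1 := le_antisymm hle (by omega)
      subst hm1
      rw [show n + 1 + 1 = n + 2 by ring, coeff_legendre_self, coeff_legendre_self,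
        coeff_eq_zero_of_natDegree_lt (by rw [natDegree_legendre]; omega),
        show n + 2 = (n + 1) + 1 by ring, legendreLead_succ (n + 1)]
      push_cast
      have h : (n : ℝ) + 1 + 1 ≠ 0 := by positivity
      field_simp
      ring
  -- orthogonality to P_k, k ≤ n
  have horth : ∀ k ≤ n, ∫ x in (-1 : ℝ)..1, D.eval x * (legendre k).eval x = 0 := by
    intro k hk
    set F : ℝ[X] := legendre (n + 2) - legendre n with hF
    have hF1 : F.eval 1 = 0 := by rw [hF, eval_sub, eval_one_legendre, eval_one_legendre, sub_self]
    have hF2 : F.eval (-1) = 0 := by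
      rw [hF, eval_sub, eval_neg_one_legendre, eval_neg_one_legendre, pow_add]; ring
    -- ∫ F' P_k = -∫ F P_k' = 0
    have hparts := integral_derivative_mul F (legendre k)
    rw [hF1, hF2, zero_mul, zero_mul, sub_zero, zero_sub] at hparts
    have hFPk : ∫ x in (-1 : ℝ)..1, F.eval x * (derivative (legendre k)).eval x = 0 := by
      have e : ∀ x, F.eval x * (derivative (legendre k)).eval x
          = (legendre (n + 2)).eval x * (derivative (legendre k)).eval x
            - (legendre n).eval x * (derivative (legendre k)).eval x := by
        intro x; rw [hF, eval_sub]; ring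
      simp_rw [e]
      rw [intervalIntegral.integral_sub (ii _ _) (ii _ _),
        integral_legendre_mul_derivative_eq_zero (by omega : k ≤ n + 2),
        integral_legendre_mul_derivative_eq_zero hk, sub_zero]
    rw [hFPk, neg_zero] at hparts
    -- ∫ P_{n+1} P_k = 0
    have hmid : ∫ x in (-1 : ℝ)..1, (legendre (n + 1)).eval x * (legendre k).eval x = 0 :=
      integral_legendre_mul_legendre_eq_zero (by omega)
    have e : ∀ x, D.eval x * (legendre k).eval x
        = (derivative F).eval x * (legendre k).eval x
          - (2 * (n : ℝ) + 3) * ((legendre (n + 1)).eval x * (legendre k).eval x) := by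
      intro x
      simp only [hD, hF, derivative_sub, eval_sub, eval_mul, eval_C]
      ring
    simp_rw [e]
    rw [intervalIntegral.integral_sub (ii _ _) (((ii _ _).const_mul _)), intervalIntegral.integral_const_mul,
      hparts, hmid, mul_zero, sub_zero]
  exact eq_zero_of_orthogonal_legendre hdeg horth

/-- Evaluated form: `P'_{m+2}(x) - P'_m(x) = (2m+3) P_{m+1}(x)`. -/
theorem eval_derivative_legendre_sub (m : ℕ) (x : ℝ) :
    (derivative (legendre (m + 2))).eval x - (derivative (legendre m)).eval x
      = (2 * (m : ℝ) + 3) * (legendre (m + 1)).eval x := by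
  have h := congrArg (fun q => q.eval x) (derivative_legendre_sub m)
  simpa only [eval_sub, eval_mul, eval_C] using h

/-! ## 3. The integration ladder (rbsdp SPEC 1.2) -/

/-- `∫_{-1}^1 P' · P_k = w_k · ĉ_k(P')` (definition of `ĉ`, rearranged). -/
theorem integral_mul_legendre_eq (q : ℝ[X]) (k : ℕ) :
    ∫ x in (-1 : ℝ)..1, q.eval x * (legendre k).eval x = w k * legCoeff q k := by
  unfold legCoeff
  rw [← mul_assoc, mul_comm (w k), norm_mul_w, one_mul]

/-- **Ladder, `n ≥ 1`**: if `P(-1) = 0` then `ĉ_{m+1}(P) = ĉ_m(P')/(2m+1) - ĉ_{m+2}(P')/(2m+5)`. -/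
theorem legCoeff_succ_of_wall (P : ℝ[X]) (hP : P.eval (-1) = 0) (m : ℕ) :
    legCoeff P (m + 1) = legCoeff (derivative P) m / (2 * (m : ℝ) + 1) - legCoeff (derivative P) (m + 2) / (2 * (m : ℝ) + 5) := by
  set F : ℝ[X] := legendre (m + 2) - legendre m with hF
  have hF1 : F.eval 1 = 0 := by rw [hF, eval_sub, eval_one_legendre, eval_one_legendre, sub_self]
  -- ∫ F' P = - ∫ F P'
  have hparts := integral_derivative_mul F P
  rw [hF1, hP, zero_mul, mul_zero, sub_zero, zero_sub] at hparts
  have hFP' : ∫ x in (-1 : ℝ)..1, F.eval x * (derivative P).eval x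
      = w (m + 2) * legCoeff (derivative P) (m + 2) - w m * legCoeff (derivative P) m := by
    have e : ∀ x, F.eval x * (derivative P).eval x
        = (derivative P).eval x * (legendre (m + 2)).eval x - (derivative P).eval x * (legendre m).eval x := by
      intro x; rw [hF, eval_sub]; ring
    simp_rw [e]
    rw [intervalIntegral.integral_sub (ii _ _) (ii _ _), integral_mul_legendre_eq, integral_mul_legendre_eq]
  -- ∫ P · P_{m+1} via F' = (2m+3) P_{m+1}
  have hmain : ∫ x in (-1 : ℝ)..1, P.eval x * (legendre (m + 1)).eval x
      = (w m * legCoeff (derivative P) m - w (m + 2) * legCoeff (derivative P) (m + 2)) / (2 * (m : ℝ) + 3) := by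
    have hne : (2 * (m : ℝ) + 3) ≠ 0 := by positivity
    rw [eq_div_iff hne]
    have e : ∀ x, P.eval x * (legendre (m + 1)).eval x * (2 * (m : ℝ) + 3) = (derivative F).eval x * P.eval x := by
      intro x
      rw [hF, derivative_sub, eval_sub, eval_derivative_legendre_sub]; ring
    rw [← intervalIntegral.integral_mul_const]
    simp_rw [e]
    rw [hparts, hFP']
    ring
  unfold legCoeff
  rw [hmain]
  simp only [legCoeff, w_eq]
  push_cast
  have h1 : (2 * (m : ℝ) + 1) ≠ 0 := by positivity
  have h2 : (2 * (m : ℝ) + 3) ≠ 0 := by positivity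
  have h3 : (2 * (m : ℝ) + 5) ≠ 0 := by positivity
  have h4 : (2 * ((m : ℝ) + 2) + 1) ≠ 0 := by positivity
  field_simp
  ring

/-- `P(1) = 2 ĉ_0(P')` when `P(-1) = 0` (`∫_{-1}^1 P' = P(1) - P(-1)`). -/
theorem eval_one_eq (P : ℝ[X]) (hP : P.eval (-1) = 0) : P.eval 1 = 2 * legCoeff (derivative P) 0 := by
  have hparts := integral_derivative_mul P 1
  simp only [eval_one, mul_one, derivative_one, eval_zero, mul_zero, intervalIntegral.integral_zero, sub_zero, hP] at hparts
  unfold legCoeff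
  rw [legendre_zero]
  simp only [Nat.cast_zero, mul_zero, zero_add, eval_one, mul_one]
  rw [hparts]; ring

/-- **Ladder, `n = 0`**: if `P(-1) = 0` then `ĉ_0(P) = ĉ_0(P') - ĉ_1(P')/3`. -/
theorem legCoeff_zero_of_wall (P : ℝ[X]) (hP : P.eval (-1) = 0) :
    legCoeff P 0 = legCoeff (derivative P) 0 - legCoeff (derivative P) 1 / 3 := by
  -- F = X + 1 = P_1 + P_0, F' = 1 = P_0
  have hparts := integral_derivative_mul (X + 1) P
  have hF' : derivative (X + 1 : ℝ[X]) = 1 := by simp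
  rw [hF'] at hparts
  simp only [eval_one, one_mul, eval_add, eval_X, hP, mul_zero, sub_zero] at hparts
  have hsplit : ∫ x in (-1 : ℝ)..1, (x + 1) * (derivative P).eval x
      = w 1 * legCoeff (derivative P) 1 + w 0 * legCoeff (derivative P) 0 := by
    rw [← integral_mul_legendre_eq, ← integral_mul_legendre_eq, ← intervalIntegral.integral_add (ii _ _) (ii _ _)]
    refine intervalIntegral.integral_congr fun x _ => ?_
    rw [legendre_one, legendre_zero, eval_X, eval_one]; ring
  rw [hsplit, eval_one_eq P hP] at hparts
  unfold legCoeff at hparts ⊢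
  rw [legendre_zero] at hparts ⊢
  simp only [Nat.cast_zero, mul_zero, zero_add, eval_one, mul_one, w_eq, Nat.cast_one] at hparts ⊢
  linarith

/-- The ladder packaged as `LadderTail.IsLadder` (coefficients of `P'` ↦ coefficients of `P`, `P(-1) = 0`). -/
theorem isLadder_legCoeff (P : ℝ[X]) (hP : P.eval (-1) = 0) : IsLadder (legCoeff (derivative P)) (legCoeff P) :=
  fun m => legCoeff_succ_of_wall P hP m

/-! ## 4. Polynomial antiderivatives vanishing at `-1` -/

/-- A polynomial antiderivative of `p`. -/
def prim (p : ℝ[X]) : ℝ[X] := ∑ n ∈ range (p.natDegree + 1), C (p.coeff n / ((n : ℝ) + 1)) * X ^ (n + 1)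

/-- `(prim p)' = p`. -/
theorem derivative_prim (p : ℝ[X]) : derivative (prim p) = p := by
  unfold prim
  rw [derivative_sum]
  conv_rhs => rw [p.as_sum_range_C_mul_X_pow]
  refine sum_congr rfl fun n _ => ?_
  rw [derivative_C_mul_X_pow]
  have h : (n : ℝ) + 1 ≠ 0 := by positivity
  congr 2
  · push_cast; field_simp
  
/-- `deg (prim p) ≤ deg p + 1`. -/
theorem natDegree_prim_le (p : ℝ[X]) : (prim p).natDegree ≤ p.natDegree + 1 := by
  unfold prim
  refine natDegree_sum_le_of_forall_le _ _ (fun n hn => ?_)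
  refine (natDegree_C_mul_X_pow_le _ _).trans ?_
  rw [mem_range] at hn; omega

/-- **The antiderivative of `p` vanishing at `x = -1`.** -/
def primFrom (p : ℝ[X]) : ℝ[X] := prim p - C ((prim p).eval (-1))

/-- `(primFrom p)' = p`. -/
theorem derivative_primFrom (p : ℝ[X]) : derivative (primFrom p) = p := by
  unfold primFrom; rw [derivative_sub, derivative_C, sub_zero, derivative_prim]

/-- `(primFrom p)(-1) = 0`. -/
theorem eval_primFrom_neg_one (p : ℝ[X]) : (primFrom p).eval (-1) = 0 := by
  unfold primFrom; simp

/-- `deg (primFrom p) ≤ deg p + 1`. -/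
theorem natDegree_primFrom_le (p : ℝ[X]) : (primFrom p).natDegree ≤ p.natDegree + 1 := by
  unfold primFrom
  rw [natDegree_sub_C]
  exact natDegree_prim_le p

/-- `(primFrom p)(x) = ∫_{-1}^x p` (fundamental theorem of calculus). -/
theorem eval_primFrom_eq_integral (p : ℝ[X]) (x : ℝ) :
    (primFrom p).eval x = ∫ t in (-1 : ℝ)..x, p.eval t := by
  have h := intervalIntegral.integral_eq_sub_of_hasDerivAt (a := (-1 : ℝ)) (b := x)
    (f := fun t => (primFrom p).eval t) (f' := fun t => p.eval t)
    (fun t _ => by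
      have := (primFrom p).hasDerivAt t
      rwa [derivative_primFrom] at this)
    (p.continuous.intervalIntegrable _ _)
  rw [h, eval_primFrom_neg_one, sub_zero]

end Summit.NavierStokesRegularity.TurbBounds.LegendreCoeffs

end
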